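import Summits.RiemannHypothesis.RiemannHypothesis.Theorems.EarlyAppointmentsRemainder0XiHeightSumAbelBound
import Literature.NumberTheory.LFunctions.ZetaZeroSumsLehmanLimits

/-!
# ⟨24730⟩ ρ2 v4 — LEAF 2 (`AbelMainLeaf`), UPPER SIDE: the T-uniform limit via Brent–Platt–Trudgian Theorem 2, PROVED

C4 «kernel desk» rh-idea-6 g30, director (CA406)(d).  SUPPORT module for crux r3 `Remainder0Xi` (line rho2_v4), fully proved,
standard axioms; imports = pre-image `…HeightSumAbelBound` (C4 g30, 089cedc0) + Literature `ZetaZeroSumsLehmanLimits` (built).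

The upper far sum of `farHeightSum x T` runs over heights in `[x + 67.5, T]` with the decreasing nonnegative kernel
`φ_up(t) = 2x/(t² − x²)` (`phiUp x`).  A single-constant Abel bound on `[x+67.5, T]` grows like `log T`; the T-UNIFORM statement is
the tree's `BrentPlattTrudgian2021_thm2`: `Σ_{T₀<γ≤T} ord·φ_up(γ) − (1/2π)∫_{T₀}^T φ_up·log(t/2π) → F_up(x,T₀)` as `T → ∞`, with
`F_up = −φ_up(T₀)·Q(T₀) − ∫_{T₀}^∞ Q·φ_up'`.  Here:
* `hasDerivAt_phiUp`, `phiUp_hyps` (C¹, `≥ 0`, `φ' ≤ 0` on `Ici T₀` for `0 < x < T₀`);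
* `hasDerivAt_gUp` / `tendsto_gUp`: the antiderivative `x⁻¹·log(1 − x²/t²)` of `φ_up(t)/t` and its limit `0`;
  `integrableOn_phiUp_div`, `integral_phiUp_div_eq : ∫_{Ioi T₀} φ_up/t = −x⁻¹·log(1 − x²/T₀²)`,
  `integral_phiUp_div_le : … ≤ 4·√T₀/x` (when `T₀² − x² ≥ 1`);
* `loglog_le_tangent`, ★ `abs_Q_le_tangent (h1 : e ≤ T₁) (ht : T₁ ≤ t) : |Q t| ≤ (0.1038 + 0.2573/log T₁)·log t + (10.2425 +
  0.2573·(log log T₁ − 1))` — the TANGENT affine majorant of the HSW envelope (C3 g41's `(0.112756, 10.8492)` at `T₁ ≈ T_PT`);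
* ★ `highSide_tendsto (hx : 0 < x) (hxT : x < T₀) (h3 : 3 ≤ T₀)` = BPT Thm 2 for `φ_up`;
* ★ `abs_Fup_le … (he : e ≤ T₀) : |F_up x T₀| ≤ 2·W_N(T₀)·φ_up(T₀) + (0.1038 + 0.2573/log T₀)·∫_{Ioi T₀} φ_up/t`,
  `W_N(T₀) = 0.1038 log T₀ + 0.2573 log log T₀ + 10.2425` (HSW at `T₀` + `BPT2021.abs_integral_Ioi_count_sub_countMain_mul_deriv_le`
  with the tangent majorant, which touches `W_N` at `T₀`).
With `T₀ = x + 67.5`: `φ_up(T₀) = 2x/(67.5(2x + 67.5)) ≤ 1/67.5` and the integral term is `≤ 0.113·4√T₀/x < 10⁻⁶`, so the upper half of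
LEAF 2 costs `2·W_N(x+67.5)/67.5 + 10⁻⁶`, symmetric with the lower half (`…AbelLowSide.lowHalf_bound`).
Nothing here bears on the truth of RH; RH is not proved; 24730 OPEN.
-/

set_option linter.dupNamespace false
namespace Summit.RiemannHypothesis.RiemannHypothesis.Theorems.EarlyAppointmentsRemainder0Xi.AbelHighSide

open Set MeasureTheory intervalIntegral Real Filter Topology
open Literature.NumberTheory.LFunctions
open Literature.NumberTheory.LFunctions.SchoenfeldBound (zerosBetween countMain)
open Summit.RiemannHypothesis.RiemannHypothesis.Theorems.EarlyAppointmentsRemainder0Xi.HeightSumAbelBound (abs_Q_le_hsw)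

/-- the upper kernel `φ_up(t) = 2x/(t² − x²)` … -/
noncomputable def phiUp (x t : ℝ) : ℝ := 2 * x / (t ^ 2 - x ^ 2)

/-- … and its derivative `−4xt/(t² − x²)²`. -/
noncomputable def phiUp' (x t : ℝ) : ℝ := -(4 * x * t) / (t ^ 2 - x ^ 2) ^ 2

/-- the limit of BPT Theorem 2 for `φ_up`: `F_up(x,T₀) = −φ_up(T₀)·Q(T₀) − ∫_{T₀}^∞ Q·φ_up'`. -/
noncomputable def Fup (x T₀ : ℝ) : ℝ :=
  -(phiUp x T₀ * ((zetaZeroCount T₀ : ℝ) - countMain T₀))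
    - ∫ t in Ioi T₀, ((zetaZeroCount t : ℝ) - countMain t) * phiUp' x t

-- (10″, C4 g31) no standalone `hasDerivAt_sq` (it duplicated `Literature.Geometry.Riemannian.HaslhoferMuller.hasDerivAt_sq'`,
-- gate bounce dedup.landed on 10′); the derivative of `s ↦ s²` is proved inline where used.

/-- The high-side kernel `phiUp x` has derivative `phiUp' x t` at every `t` with `t² ≠ x²`. -/
theorem hasDerivAt_phiUp {x t : ℝ} (ht : t ^ 2 ≠ x ^ 2) : HasDerivAt (phiUp x) (phiUp' x t) t := by
  have hds : HasDerivAt (fun s : ℝ ↦ s ^ 2) (2 * t) t := by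
    have h := (hasDerivAt_id t).mul (hasDerivAt_id t)
    have e1 : (fun s : ℝ ↦ s ^ 2) = fun s ↦ id s * id s := by
      funext s; simp [sq]
    have e2 : 2 * t = 1 * id t + id t * 1 := by simp; ring
    rw [e1, e2]
    exact h
  have h1 : HasDerivAt (fun s : ℝ ↦ s ^ 2 - x ^ 2) (2 * t) t := hds.sub_const (x ^ 2)
  have hne : t ^ 2 - x ^ 2 ≠ 0 := sub_ne_zero.2 ht
  have h := (hasDerivAt_const t (2 * x)).div h1 hne
  have e : (0 * (t ^ 2 - x ^ 2) - 2 * x * (2 * t)) / (t ^ 2 - x ^ 2) ^ 2 = -(4 * x * t) / (t ^ 2 - x ^ 2) ^ 2 := by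
    ring
  rw [e] at h
  exact h

/-- `φ_up` is `C¹`, nonnegative and nonincreasing on `Ici T₀` when `0 < x < T₀`. -/
theorem phiUp_hyps {x T₀ : ℝ} (hx : 0 < x) (hxT : x < T₀) :
    (∀ t ∈ Ici T₀, HasDerivAt (phiUp x) (phiUp' x t) t) ∧ ContinuousOn (phiUp' x) (Ici T₀) ∧
    (∀ t ∈ Ici T₀, 0 ≤ phiUp x t) ∧ (∀ t ∈ Ici T₀, phiUp' x t ≤ 0) := by
  have hsq : ∀ t ∈ Ici T₀, x ^ 2 < t ^ 2 := fun t ht ↦ by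
    have h : x < t := lt_of_lt_of_le hxT (Set.mem_Ici.1 ht)
    nlinarith
  refine ⟨fun t ht ↦ hasDerivAt_phiUp (hsq t ht).ne', ?_, fun t ht ↦ ?_, fun t ht ↦ ?_⟩
  · unfold phiUp'
    refine ContinuousOn.div (by fun_prop) (by fun_prop) fun t ht ↦ ?_
    exact pow_ne_zero 2 (sub_ne_zero.2 (hsq t ht).ne')
  · unfold phiUp
    exact div_nonneg (by linarith) (by linarith [hsq t ht])
  · unfold phiUp'
    have ht0 : 0 ≤ t := by linarith [lt_of_lt_of_le hxT (Set.mem_Ici.1 ht)]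
    rw [neg_div]
    exact neg_nonpos.2 (div_nonneg (by positivity) (by positivity))

/-- the antiderivative `g(t) = x⁻¹·log(1 − x²/t²)` of `φ_up(t)/t` on `t > x > 0`. -/
theorem hasDerivAt_gUp {x t : ℝ} (hx : 0 < x) (hxt : x < t) :
    HasDerivAt (fun s : ℝ ↦ x⁻¹ * Real.log (1 - x ^ 2 / s ^ 2)) (phiUp x t / t) t := by
  have ht0 : 0 < t := hx.trans hxt
  have ht2 : 0 < t ^ 2 := by positivity
  have hsq : x ^ 2 < t ^ 2 := by nlinarith
  have hds : HasDerivAt (fun s : ℝ ↦ s ^ 2) (2 * t) t := by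
    have h := (hasDerivAt_id t).mul (hasDerivAt_id t)
    have e1 : (fun s : ℝ ↦ s ^ 2) = fun s ↦ id s * id s := by
      funext s; simp [sq]
    have e2 : 2 * t = 1 * id t + id t * 1 := by simp; ring
    rw [e1, e2]
    exact h
  have h2 : HasDerivAt (fun s : ℝ ↦ 1 - x ^ 2 / s ^ 2) (-((0 * t ^ 2 - x ^ 2 * (2 * t)) / (t ^ 2) ^ 2)) t :=
    ((hasDerivAt_const t (x ^ 2)).div hds ht2.ne').const_sub 1
  have hlt1 : x ^ 2 / t ^ 2 < 1 := by rw [div_lt_one ht2]; exact hsq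
  have hpos : 1 - x ^ 2 / t ^ 2 ≠ 0 := by linarith
  have h3 := (h2.log hpos).const_mul x⁻¹
  have hne : t ^ 2 - x ^ 2 ≠ 0 := by linarith
  have e : x⁻¹ * (-((0 * t ^ 2 - x ^ 2 * (2 * t)) / (t ^ 2) ^ 2) / (1 - x ^ 2 / t ^ 2)) = phiUp x t / t := by
    unfold phiUp
    have e1 : 1 - x ^ 2 / t ^ 2 = (t ^ 2 - x ^ 2) / t ^ 2 := by field_simp
    rw [e1]
    field_simp
    ring
  rw [e] at h3
  exact h3

/-- The antiderivative `x⁻¹·log(1 − x²/s²)` of the high-side kernel tends to `0` as `s → ∞`. -/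
theorem tendsto_gUp {x : ℝ} : Tendsto (fun s : ℝ ↦ x⁻¹ * Real.log (1 - x ^ 2 / s ^ 2)) atTop (𝓝 0) := by
  have h1 : Tendsto (fun s : ℝ ↦ (s ^ 2)⁻¹) atTop (𝓝 0) :=
    tendsto_inv_atTop_zero.comp (tendsto_pow_atTop two_ne_zero)
  have h2 : Tendsto (fun s : ℝ ↦ 1 - x ^ 2 / s ^ 2) atTop (𝓝 1) := by
    have h := (h1.const_mul (x ^ 2)).const_sub 1
    simp only [mul_zero, sub_zero] at h
    refine h.congr' (Eventually.of_forall fun s ↦ ?_)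
    simp [div_eq_mul_inv]
  have h3 : Tendsto (fun s : ℝ ↦ Real.log (1 - x ^ 2 / s ^ 2)) atTop (𝓝 0) := by
    have h := (Real.continuousAt_log one_ne_zero).tendsto.comp h2
    rw [Real.log_one] at h
    exact h
  have h4 := h3.const_mul x⁻¹
  rw [mul_zero] at h4
  exact h4

/-- `phiUp x t / t ≥ 0` for `0 < x < t`. -/
theorem phiUp_div_nonneg {x t : ℝ} (hx : 0 < x) (hxt : x < t) : 0 ≤ phiUp x t / t := by
  unfold phiUp
  exact div_nonneg (div_nonneg (by linarith) (by nlinarith)) (by linarith)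

/-- `t ↦ phiUp x t / t` is integrable on `(T₀, ∞)` when `0 < x < T₀`. -/
theorem integrableOn_phiUp_div {x T₀ : ℝ} (hx : 0 < x) (hxT : x < T₀) :
    IntegrableOn (fun t ↦ phiUp x t / t) (Ioi T₀) :=
  integrableOn_Ioi_deriv_of_nonneg (hasDerivAt_gUp hx hxT).continuousAt.continuousWithinAt
    (fun _ ht ↦ hasDerivAt_gUp hx (hxT.trans (Set.mem_Ioi.1 ht)))
    (fun _ ht ↦ phiUp_div_nonneg hx (hxT.trans (Set.mem_Ioi.1 ht))) tendsto_gUp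

/-- `∫_{T₀}^∞ φ_up(t)/t dt = −x⁻¹·log(1 − x²/T₀²)` (`= x⁻¹·log(T₀²/(T₀² − x²))`). -/
theorem integral_phiUp_div_eq {x T₀ : ℝ} (hx : 0 < x) (hxT : x < T₀) :
    ∫ t in Ioi T₀, phiUp x t / t = -(x⁻¹ * Real.log (1 - x ^ 2 / T₀ ^ 2)) := by
  rw [integral_Ioi_of_hasDerivAt_of_nonneg (hasDerivAt_gUp hx hxT).continuousAt.continuousWithinAt
    (fun _ ht ↦ hasDerivAt_gUp hx (hxT.trans (Set.mem_Ioi.1 ht)))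
    (fun _ ht ↦ phiUp_div_nonneg hx (hxT.trans (Set.mem_Ioi.1 ht))) tendsto_gUp]
  ring

/-- crude uniform bound: `∫_{T₀}^∞ φ_up/t ≤ 4·√T₀/x` whenever `T₀² − x² ≥ 1`. -/
theorem integral_phiUp_div_le {x T₀ : ℝ} (hx : 0 < x) (hxT : x < T₀) (h1 : 1 ≤ T₀ ^ 2 - x ^ 2) :
    ∫ t in Ioi T₀, phiUp x t / t ≤ 4 * Real.sqrt T₀ / x := by
  rw [integral_phiUp_div_eq hx hxT]
  have hT0 : 0 < T₀ := hx.trans hxT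
  have hT2 : 0 < T₀ ^ 2 := by positivity
  have hapos : 0 < 1 - x ^ 2 / T₀ ^ 2 := by
    have : x ^ 2 / T₀ ^ 2 < 1 := by rw [div_lt_one hT2]; nlinarith
    linarith
  -- −log a = log a⁻¹ ≤ log (T₀²) = 2 log T₀ ≤ 4 √T₀
  have hinv : (1 - x ^ 2 / T₀ ^ 2)⁻¹ ≤ T₀ ^ 2 := by
    rw [inv_le_iff_one_le_mul₀ hapos]
    have e : T₀ ^ 2 * (1 - x ^ 2 / T₀ ^ 2) = T₀ ^ 2 - x ^ 2 := by field_simp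
    rw [e]
    exact h1
  have hlog : -Real.log (1 - x ^ 2 / T₀ ^ 2) ≤ 2 * Real.log T₀ := by
    have h := Real.log_le_log (inv_pos.2 hapos) hinv
    rw [Real.log_inv, Real.log_pow] at h
    norm_num at h
    linarith
  have hsqrt : Real.log T₀ ≤ 2 * Real.sqrt T₀ := by
    have h := Real.log_le_rpow_div hT0.le (by norm_num : (0 : ℝ) < 1 / 2)
    rw [← Real.sqrt_eq_rpow] at h
    have : Real.sqrt T₀ / (1 / 2) = 2 * Real.sqrt T₀ := by ring
    linarith
  have hxinv : 0 < x⁻¹ := inv_pos.2 hx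
  calc -(x⁻¹ * Real.log (1 - x ^ 2 / T₀ ^ 2)) = x⁻¹ * (-Real.log (1 - x ^ 2 / T₀ ^ 2)) := by ring
    _ ≤ x⁻¹ * (4 * Real.sqrt T₀) := mul_le_mul_of_nonneg_left (by linarith) hxinv.le
    _ = 4 * Real.sqrt T₀ / x := by ring

/-- the tangent-line bound `log log t ≤ log log T₁ + (log t / log T₁ − 1)` for `e ≤ T₁ ≤ t`. -/
theorem loglog_le_tangent {T₁ t : ℝ} (h1 : Real.exp 1 ≤ T₁) (ht : T₁ ≤ t) :
    Real.log (Real.log t) ≤ Real.log (Real.log T₁) + (Real.log t / Real.log T₁ - 1) := by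
  have hT0 : 0 < T₁ := lt_of_lt_of_le (Real.exp_pos 1) h1
  have hl1 : 1 ≤ Real.log T₁ := by rw [Real.le_log_iff_exp_le hT0]; exact h1
  have hl1pos : 0 < Real.log T₁ := by linarith
  have hlt : Real.log T₁ ≤ Real.log t := Real.log_le_log hT0 ht
  have hltpos : 0 < Real.log t := by linarith
  have hq : 0 < Real.log t / Real.log T₁ := div_pos hltpos hl1pos
  have h := Real.log_le_sub_one_of_pos hq
  rw [Real.log_div hltpos.ne' hl1pos.ne'] at h
  linarith

/-- ★ (K) the TANGENT affine majorant of the HSW envelope: for `e ≤ T₁ ≤ t`,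
`|N(t) − countMain(t)| ≤ (0.1038 + 0.2573/log T₁)·log t + (10.2425 + 0.2573·(log log T₁ − 1))`. -/
theorem abs_Q_le_tangent {T₁ t : ℝ} (h1 : Real.exp 1 ≤ T₁) (ht : T₁ ≤ t) :
    |(zetaZeroCount t : ℝ) - countMain t| ≤
      (0.1038 + 0.2573 / Real.log T₁) * Real.log t + (10.2425 + 0.2573 * (Real.log (Real.log T₁) - 1)) := by
  have hQ := abs_Q_le_hsw (t := t) (le_trans h1 ht)
  have hl := loglog_le_tangent h1 ht
  have e : (0.1038 + 0.2573 / Real.log T₁) * Real.log t =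
      0.1038 * Real.log t + 0.2573 * (Real.log t / Real.log T₁) := by ring
  rw [e]
  linarith

/-- ★ (K) **UPPER SIDE of LEAF 2 — the T-uniform limit** (Brent–Platt–Trudgian Theorem 2 for `φ_up`): for `0 < x < T₀`, `3 ≤ T₀`,
`Σ_{T₀<γ≤T} ord·φ_up(γ) − (∫_{T₀}^T φ_up·log(t/2π))/(2π) → F_up(x,T₀)` as `T → ∞`. -/
theorem highSide_tendsto {x T₀ : ℝ} (hx : 0 < x) (hxT : x < T₀) (h3 : 3 ≤ T₀) :
    Tendsto (fun T ↦ ∑ ρ ∈ zerosBetween T₀ T, (riemannZetaZeroOrder ρ : ℝ) * phiUp x ρ.im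
        - (∫ t in T₀..T, phiUp x t * Real.log (t / (2 * π))) / (2 * π)) atTop (𝓝 (Fup x T₀)) := by
  obtain ⟨hφ, hφ'c, hφ0, hφ'0⟩ := phiUp_hyps hx hxT
  exact BrentPlattTrudgian2021_thm2 h3 hφ hφ'c hφ0 hφ'0 (integrableOn_phiUp_div hx hxT)

/-- ★ (K) **the limit is small**: `|F_up(x,T₀)| ≤ 2·W_N(T₀)·φ_up(T₀) + (0.1038 + 0.2573/log T₀)·∫_{T₀}^∞ φ_up/t` for `e ≤ T₀`,
`3 ≤ T₀`, `0 < x < T₀`. -/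
theorem abs_Fup_le {x T₀ : ℝ} (hx : 0 < x) (hxT : x < T₀) (h3 : 3 ≤ T₀) (he : Real.exp 1 ≤ T₀) :
    |Fup x T₀| ≤ 2 * (0.1038 * Real.log T₀ + 0.2573 * Real.log (Real.log T₀) + 10.2425) * phiUp x T₀
        + (0.1038 + 0.2573 / Real.log T₀) * ∫ t in Ioi T₀, phiUp x t / t := by
  obtain ⟨hφ, hφ'c, hφ0, hφ'0⟩ := phiUp_hyps hx hxT
  have hint := integrableOn_phiUp_div hx hxT
  have hT0 : 0 < T₀ := by linarith
  have hl1 : 1 ≤ Real.log T₀ := by rw [Real.le_log_iff_exp_le hT0]; exact he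
  have hlpos : 0 < Real.log T₀ := by linarith
  have hll0 : 0 ≤ Real.log (Real.log T₀) := Real.log_nonneg hl1
  have hA : (0 : ℝ) ≤ 0.1038 + 0.2573 / Real.log T₀ := by positivity
  have hB : (0 : ℝ) ≤ 10.2425 + 0.2573 * (Real.log (Real.log T₀) - 1) := by nlinarith
  have hI := BPT2021.abs_integral_Ioi_count_sub_countMain_mul_deriv_le h3 hA hB
    (fun t ht ↦ abs_Q_le_tangent he ht) hφ hφ'c hφ0 hφ'0 hint
  have hQ0 := abs_Q_le_hsw (t := T₀) he
  have hφT : 0 ≤ phiUp x T₀ := hφ0 T₀ Set.self_mem_Ici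
  have h1 : |phiUp x T₀ * ((zetaZeroCount T₀ : ℝ) - countMain T₀)| ≤
      (0.1038 * Real.log T₀ + 0.2573 * Real.log (Real.log T₀) + 10.2425) * phiUp x T₀ := by
    rw [abs_mul, abs_of_nonneg hφT, mul_comm]
    exact mul_le_mul_of_nonneg_right hQ0 hφT
  have htouch : (0.1038 + 0.2573 / Real.log T₀) * Real.log T₀ + (10.2425 + 0.2573 * (Real.log (Real.log T₀) - 1)) =
      0.1038 * Real.log T₀ + 0.2573 * Real.log (Real.log T₀) + 10.2425 := by
    field_simp
    ring
  rw [htouch] at hI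
  have htri := abs_sub (-(phiUp x T₀ * ((zetaZeroCount T₀ : ℝ) - countMain T₀)))
    (∫ t in Ioi T₀, ((zetaZeroCount t : ℝ) - countMain t) * phiUp' x t)
  rw [abs_neg] at htri
  unfold Fup
  linarith

end Summit.RiemannHypothesis.RiemannHypothesis.Theorems.EarlyAppointmentsRemainder0Xi.AbelHighSide
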